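import Summits.Schanuel.Schanuel.Theorems.RootDecomp1KXLinear05
import Literature.NumberTheory.DiophantineApproximation.RidoutRationalsZero

/-!
# RootDecomp1KXLinearII — lens 1, generation 45, node 3 (g45c) «THE OTHER PLACE AT ∞: ALL x-LINEAR CURVES A(Y) + x·B(Y) WITH B SEPARABLE OVER ℚ, ANY DEGREES, EVERY m₀ ≥ 3» (RULE K-R33 (ii); CLAIM L2288, ACK/CHECKLIST K-g45c L2290 = PRICE THEOREM ×1, NODE L2299; critic VERDICT pending at staging — filed only on GO and only once Literature RidoutRationalsZero builds on the farm) — continuation (RootDecomp1KXLinearII01): §XII part 1 — Ridout for rationals by tree name (ridout_one, ridout_window), psNumer norm, roots data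

(lens-1 g45c HOME kernel K₃ = HOME/decomp-schanuel-lens-1/g45c/DLxlinear2.lean ce89a773… 4482 l = K₂ (tree: DegreeLadder01–09 + XLinear01–05) + §XII xii_tail.lean 644 l (ns `…RootDecomp1KXLinearII`). Port by census-1 gen 19 as `RootDecomp1KXLinearII01–03` importing tree XLinear05 + Literature RidoutRationalsZero: 01 = the Diophantine input fed BY TREE NAME (`ridout_one (Q) …` with `Ridout.finite_of_abs_le_one` at S = {2}, κ = 5/2; `ridout_window`), `norm_psNumer`, `norm_aeval_le`, `roots_data`; 02 = NEAREST ROOT `nearest_root`, `caseII_close`, `dichotomy_arith`; 03 = `levels_finite_of_B_ne`, `thinFibreAt_xLinear_sep (A B) (hsep : (B.map (Int.castRingHom ℚ)).Separable) (hle : A.natDegree ≤ B.natDegree) (hm : 3 ≤ m₀) : ThinFibreAt m₀ (xLinP A B)` (scoped `maxHeartbeats 400000` as in K), the UNION `thinFibreAt_xLinear_of_sep` (any degrees; case split with the tree's `thinFibreAt_xLinear_of_lt`), instances `thinFibreAt_lineP` (m₀ ≥ 3), `thinFibreAt_fermatTwist`, the consumer `xLinearSep_nonvanishing (hm : 3 ≤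 m) (hρ : SkelLiouvilleFix m ρ) (A B) (hsep) : aeval ρ A + liouvilleNumber 2 * aeval ρ B ≠ 0` — ALL HYPOTHESIS-FREE.
PORT EDITS: the `def PadicRothRat` DELETED and the `(hR : PadicRothRat)` binder REMOVED from the seven decls that carried it, `Literature.NumberTheory.DiophantineApproximation.Ridout.finite_of_abs_le_one` fed directly at the one use site in `ridout_one` (same shape as DegreeLadder09 / XLinear01, critic L2282 (b)/(d)); node-2 primed names re-pointed to the tree's unprimed binder-free forms (`thinFibreAt_xLinear_of_lt`, `xLinear_nonvanishing`); `open …XLinearCore (norm_two …)` ↦ unrestricted open + private copies (those Core lemmas are private in the tree port); linter option dropped; two docstrings added; two generic helpers private; statements and proofs otherwise verbatim. `--supports stmt-Schanuel-33364`; no census credit; rung 0.)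
-/

noncomputable section

namespace Summit.Schanuel.Schanuel.Theorems.RootDecomp1KXLinearII

open Polynomial LiouvilleNumber
open scoped Nat
open Summit.Schanuel.Schanuel.Theorems.RootDecomp1KSkelCell
  (exists_le_two_pow_factorial iota iota_spec iota_le_of_le pow_lt_of_lt_iota lt_iota_of_pow_lt iota_mono
   one_le_iota SkelLiouville SkelLiouvilleFix skelLiouville_iff_fix SkelLiouvilleFix.mono uStar dU rU dU_cast
   two_pow_le_four_mul_dU two_mul_dU_lt one_le_dU rU_den rU_cast uStar_sub_rU skelLiouvilleFix_one_uStar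
   not_skelFixOne_algebraicIndependent)
open Summit.Schanuel.Schanuel.Theorems.RootDecomp1KTwoBaseCell (psNumer partialSum_eq_psNumer_div coprime_psNumer
  algebraicIndependent_of_forall_int')
open Summit.Schanuel.Schanuel.Theorems.RootDecomp1KRelLiouvilleCell (partialSum_two_strictMono
  partialSum_two_lt_liouvilleNumber abs_liouvilleNumber_two_sub_partialSum)
open Summit.Schanuel.Schanuel.Theorems.RootDecomp1KDegreeLadder
open Summit.Schanuel.Schanuel.Theorems.RootDecomp1KXLinearCore
open Summit.Schanuel.Schanuel.Theorems.RootDecomp1KXLinear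

/-- `‖(z : \overline{ℚ₂})‖ ≤ 1` for integers. -/
private theorem norm_intCast_le_one' (z : ℤ) : ‖(z : PadicAlgCl 2)‖ ≤ 1 := by
  have h1 : (z : PadicAlgCl 2) = algebraMap ℚ_[2] (PadicAlgCl 2) (z : ℚ_[2]) := (map_intCast _ z).symm
  rw [h1, PadicAlgCl.norm_extends]
  exact Padic.norm_int_le_one z

/-- `N ≤ N! − (N−1)!` for `N ≥ 3`. -/
private theorem factorial_sub_ge {N : ℕ} (hN : 3 ≤ N) : N ≤ (N)! - (N - 1)! := by
  obtain ⟨n, rfl⟩ : ∃ n, N = n + 1 := ⟨N - 1, by omega⟩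
  have hsub : (n + 1)! - (n + 1 - 1)! = n * n ! := by
    rw [Nat.add_sub_cancel, Nat.factorial_succ, Nat.succ_mul, Nat.add_sub_cancel]
  rw [hsub]
  have h2 : 2 ≤ n ! := (show 2 ≤ n by omega).trans (Nat.self_le_factorial n)
  nlinarith

set_option maxHeartbeats 800000 in

/-!
# RootDecomp1K — x-linear thin fibres II: THE OTHER PLACE AT `∞` (`deg B ≥ deg A`, `B` separable, `m₀ ≥ 3`)
(lens-1 g45, node 3 = g45c).

For `P = A(Y) + x·B(Y)` with `deg A ≤ deg B`, `B` separable over `ℚ`, the bounded rational points `r` on the level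
`x = s_N = p_N / 2^{N!}` satisfy `‖B(r)‖₂ = 2^{−N!}‖A(r)‖₂` (`p_N` is odd), whence `r` itself is `2^{−N!}`-close in
`ℂ₂ = PadicAlgCl 2` to a root `β` of `B` (nearest-root lemma; `‖r‖₂` is bounded for large `N` by a degree
comparison).  DICHOTOMY per point: either the RIDOUT INEQUALITY `den(r)^5 · ‖lc_B (r − β)‖₂² ≤ 1` holds — then `r`
lies in a finite set by Ridout's theorem for RATIONALS at the place `2` (Roth exponent `5/2 > 2`; tree
`Ridout.finite_of_abs_le_one`, Bombieri–Gubler Thm. 6.2.3 over `ℚ`, fed BY TREE NAME at port (K carried its type as a hypothesis `PadicRothRat`, the farm snapshot having the module unbuilt)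
verbatim) and each such `r` sits on at most one level — or it fails, and then `den(r)^5 > 4^{N!}/c²` forces
`den(r)^{m₀ N} ≥ den(r)^{3N} > C·2^{(N+1)!}` for `N` large.  No valuation relation, no Newton step, no integer `Z`.
-/

/-! ### The Diophantine input: Ridout's theorem for RATIONALS over `ℚ` -/

/-- the square-root step: `d^5·x² ≤ 1`, `x ≥ 0`, `d > 0` ⇒ `x ≤ d^{−5/2}`. -/
private theorem le_rpow_of_sq (x d : ℝ) (hx : 0 ≤ x) (hd : 0 < d) (h : d ^ 5 * x ^ 2 ≤ 1) :
    x ≤ d ^ (-(5 / 2 : ℝ)) := by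
  set y : ℝ := d ^ (-(5 / 2 : ℝ)) with hy
  have hypos : 0 < y := Real.rpow_pos_of_pos hd _
  have hy2 : y ^ 2 = (d ^ 5)⁻¹ := by
    rw [hy, ← Real.rpow_natCast (d ^ (-(5 / 2 : ℝ))) 2, ← Real.rpow_mul hd.le,
      show (-(5 / 2 : ℝ)) * ((2 : ℕ) : ℝ) = -((5 : ℕ) : ℝ) by norm_num, Real.rpow_neg hd.le, Real.rpow_natCast]
  have hx2 : x ^ 2 ≤ y ^ 2 := by
    rw [hy2, inv_eq_one_div, le_div_iff₀ (by positivity)]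
    linarith
  nlinarith

/-- One target `θ ∈ ℂ₂`, root of a monic `Q ∈ ℤ[X]`, exponent `5/2`: the rationals `ρ`, `|ρ| ≤ 1`, with
`den(ρ)^5 · ‖ρ − θ‖₂² ≤ 1` form a finite set. -/
theorem ridout_one (Q : ℤ[X]) (hQm : Q.Monic) (hQd : 1 ≤ Q.natDegree)
    (θ : PadicAlgCl 2) (hθ : aeval θ Q = 0) :
    {ρ : ℚ | |(ρ : ℝ)| ≤ 1 ∧ (ρ.den : ℝ) ^ 5 * ‖(ρ : PadicAlgCl 2) - θ‖ ^ 2 ≤ 1}.Finite := by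
  classical
  let α : ∀ p : Nat.Primes, @PadicAlgCl (p : ℕ) ⟨p.2⟩ := fun p =>
    if hp : p = pTwo then (by subst hp; exact θ) else 0
  have hα : α pTwo = θ := by
    show (if hp : pTwo = pTwo then _ else _) = _
    rw [dif_pos rfl]
  have hroot : ∀ p ∈ ({pTwo} : Finset Nat.Primes), Polynomial.aeval (α p) ((fun _ => Q) p) = 0 := by
    intro p hp
    rw [Finset.mem_singleton] at hp
    subst hp
    rw [hα]
    exact hθ
  have hF := Literature.NumberTheory.DiophantineApproximation.Ridout.finite_of_abs_le_one {pTwo} (fun _ => Q) (fun _ _ => hQm) (fun _ _ => hQd) α hroot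
    (show (2 : ℝ) < 5 / 2 by norm_num)
  refine hF.subset fun ρ hρ => ?_
  obtain ⟨h1, h2⟩ := hρ
  refine ⟨h1, ?_⟩
  show |(ρ : ℝ)| * (∏ p ∈ ({pTwo} : Finset Nat.Primes), min (1 : ℝ) ‖((ρ : ℚ) : @PadicAlgCl (p : ℕ) ⟨p.2⟩) - α p‖)
    ≤ (ρ.den : ℝ) ^ (-(5 / 2 : ℝ))
  rw [Finset.prod_singleton]
  have e1 : min (1 : ℝ) ‖((ρ : ℚ) : PadicAlgCl 2) - α pTwo‖ = min (1 : ℝ) ‖(ρ : PadicAlgCl 2) - θ‖ := by rw [hα]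
  rw [e1]
  have hx0 : 0 ≤ ‖(ρ : PadicAlgCl 2) - θ‖ := norm_nonneg _
  have hd : (0 : ℝ) < ρ.den := by exact_mod_cast ρ.den_pos
  calc |(ρ : ℝ)| * min (1 : ℝ) ‖(ρ : PadicAlgCl 2) - θ‖ ≤ 1 * ‖(ρ : PadicAlgCl 2) - θ‖ :=
        mul_le_mul h1 (min_le_right _ _) (le_min zero_le_one hx0) zero_le_one
    _ = ‖(ρ : PadicAlgCl 2) - θ‖ := one_mul _
    _ ≤ (ρ.den : ℝ) ^ (-(5 / 2 : ℝ)) := le_rpow_of_sq _ _ hx0 hd h2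

/-- **Ridout, packaged for the curve**: for `B ∈ ℤ[Y]` of degree `≥ 1` and a window `|r| ≤ C`, the rationals `r`
with a root `β ∈ ℂ₂` of `B` such that `den(r)^5 · ‖lc_B·(r − β)‖₂² ≤ 1` form a finite set.  (Cover `|r| ≤ C` by the
integer shifts `ρ = lc_B·r − n`, `|ρ| ≤ 1`; the target `lc_B·β − n` is a root of the MONIC
`(integralNormalization B).comp (X + n)`; `den ρ ≤ den r`.) -/
theorem ridout_window (B : ℤ[X]) (hb : 1 ≤ B.natDegree) (C : ℝ) :
    {r : ℚ | |(r : ℝ)| ≤ C ∧ ∃ β : PadicAlgCl 2, aeval β B = 0 ∧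
      (r.den : ℝ) ^ 5 * ‖(B.leadingCoeff : PadicAlgCl 2) * ((r : PadicAlgCl 2) - β)‖ ^ 2 ≤ 1}.Finite := by
  classical
  have hB : B ≠ 0 := by rintro rfl; simp at hb
  set ℓ : ℤ := B.leadingCoeff with hℓ
  have hℓ0 : ℓ ≠ 0 := leadingCoeff_ne_zero.mpr hB
  set Q : ℤ[X] := integralNormalization B with hQ
  have hQm : Q.Monic := monic_integralNormalization hB
  have hQd : 1 ≤ Q.natDegree := by rw [hQ, natDegree_integralNormalization]; exact hb
  -- roots of `B` in `ℂ₂` ↦ roots of `Q`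
  have hQroot : ∀ β : PadicAlgCl 2, aeval β B = 0 → aeval ((ℓ : PadicAlgCl 2) * β) Q = 0 := by
    intro β hβ
    have h := integralNormalization_aeval_eq_zero (A := PadicAlgCl 2) hβ
      (fun x hx => by simpa using hx)
    simpa [hℓ] using h
  -- shifted monic polynomials
  have hQn : ∀ n : ℤ, (Q.comp (X + Polynomial.C n)).Monic ∧ 1 ≤ (Q.comp (X + Polynomial.C n)).natDegree ∧
      ∀ β : PadicAlgCl 2, aeval β B = 0 → aeval ((ℓ : PadicAlgCl 2) * β - n) (Q.comp (X + Polynomial.C n)) = 0 := by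
    intro n
    refine ⟨hQm.comp (monic_X_add_C n) (by rw [natDegree_X_add_C]; exact one_ne_zero), ?_, ?_⟩
    · rw [natDegree_comp, natDegree_X_add_C, mul_one]; exact hQd
    · intro β hβ
      rw [aeval_comp]
      simpa using hQroot β hβ
  -- the finite set of roots of `B` in `ℂ₂`
  have hroots : {β : PadicAlgCl 2 | aeval β B = 0}.Finite := by
    have h := B.rootSet_finite (PadicAlgCl 2)
    refine h.subset fun β hβ => ?_
    rw [mem_rootSet]
    exact ⟨hB, hβ⟩
  -- integer shifts
  obtain ⟨K, hK⟩ : ∃ K : ℕ, |(ℓ : ℝ)| * |C| + 1 ≤ K := exists_nat_ge _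
  have hshifts : (Set.Icc (-(K : ℤ)) K).Finite := Set.finite_Icc _ _
  -- the cover
  apply Set.Finite.subset (Set.Finite.biUnion hshifts fun n _ => Set.Finite.biUnion hroots fun β _ =>
    Set.Finite.preimage (f := fun r : ℚ => (ℓ : ℚ) * r - n) ?_ (ridout_one _ (hQn n).1 (hQn n).2.1
      ((ℓ : PadicAlgCl 2) * β - n) ((hQn n).2.2 β ‹β ∈ {β | aeval β B = 0}›)))
  · intro r hr
    obtain ⟨hrC, β, hβ, hineq⟩ := hr
    simp only [Set.mem_iUnion, Set.mem_preimage, Set.mem_setOf_eq, exists_prop]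
    set n : ℤ := ⌊(ℓ : ℚ) * r⌋ with hn
    have hn1 : (n : ℚ) ≤ (ℓ : ℚ) * r := Int.floor_le _
    have hn2 : (ℓ : ℚ) * r < n + 1 := Int.lt_floor_add_one _
    refine ⟨n, ?_, β, hβ, ?_, ?_⟩
    · -- `|n| ≤ K`
      have hlr : |((ℓ : ℚ) * r : ℚ)| ≤ |(ℓ : ℝ)| * |C| := by
        push_cast
        rw [abs_mul]
        exact mul_le_mul_of_nonneg_left (hrC.trans (le_abs_self C)) (abs_nonneg _)
      have hn1R : (n : ℝ) ≤ (ℓ : ℝ) * r := by exact_mod_cast hn1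
      have hn2R : (ℓ : ℝ) * r < n + 1 := by exact_mod_cast hn2
      have hlr' : |(ℓ : ℝ) * r| ≤ |(ℓ : ℝ)| * |C| := by
        have : (((ℓ : ℚ) * r : ℚ) : ℝ) = (ℓ : ℝ) * r := by push_cast; ring
        rw [← this]; exact_mod_cast hlr
      have h3 := abs_le.mp hlr'
      constructor
      · have : (-(K : ℝ)) ≤ n := by linarith
        exact_mod_cast this
      · have : (n : ℝ) ≤ K := by linarith
        exact_mod_cast this
    · -- `|ρ| ≤ 1`
      have e : ((((ℓ : ℚ) * r - n : ℚ)) : ℝ) = (ℓ : ℝ) * r - n := by push_cast; ring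
      rw [e, abs_le]
      have hn1R : (n : ℝ) ≤ (ℓ : ℝ) * r := by exact_mod_cast hn1
      have hn2R : (ℓ : ℝ) * r < n + 1 := by exact_mod_cast hn2
      constructor <;> linarith
    · -- the inequality, with `den ρ ≤ den r`
      have hden : (((ℓ : ℚ) * r - n : ℚ)).den ≤ r.den := by
        rw [Rat.sub_intCast_den]
        have h2 : ((ℓ : ℚ) * r).den ∣ (ℓ : ℚ).den * r.den := Rat.mul_den_dvd _ _
        rw [Rat.den_intCast, one_mul] at h2
        exact Nat.le_of_dvd r.den_pos h2
      have e2 : ((((ℓ : ℚ) * r - n : ℚ)) : PadicAlgCl 2) - ((ℓ : PadicAlgCl 2) * β - n) =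
          (ℓ : PadicAlgCl 2) * ((r : PadicAlgCl 2) - β) := by push_cast; ring
      rw [e2]
      have hdenR : ((((ℓ : ℚ) * r - n : ℚ)).den : ℝ) ≤ r.den := by exact_mod_cast hden
      calc ((((ℓ : ℚ) * r - n : ℚ)).den : ℝ) ^ 5 * ‖(ℓ : PadicAlgCl 2) * ((r : PadicAlgCl 2) - β)‖ ^ 2
          ≤ (r.den : ℝ) ^ 5 * ‖(ℓ : PadicAlgCl 2) * ((r : PadicAlgCl 2) - β)‖ ^ 2 := by gcongr
        _ ≤ 1 := hineq
  · -- injectivity of the shift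
    intro r₁ _ r₂ _ h
    have h' : (ℓ : ℚ) * r₁ - n = (ℓ : ℚ) * r₂ - n := h
    have hℓQ : (ℓ : ℚ) ≠ 0 := by exact_mod_cast hℓ0
    exact mul_left_cancel₀ hℓQ (by linarith)

/-! ### 2-adic analysis of the points at the place `deg B ≥ deg A` -/

/-- `‖p_N‖₂ = 1` (`p_N` is odd; here from `‖p_N − 1‖₂ < 1`). -/
theorem norm_psNumer {N : ℕ} (hN : 3 ≤ N) : ‖(psNumer 2 N : PadicAlgCl 2)‖ = 1 := by
  have h := norm_psNumer_sub_one (show 1 ≤ N by omega)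
  have hE : 1 ≤ Nat.factorial N - Nat.factorial (N - 1) := le_trans (by omega) (factorial_sub_ge hN)
  have hlt : ‖(psNumer 2 N : PadicAlgCl 2) - 1‖ < 1 := by
    refine h.trans_lt ?_
    calc (1 / 2 : ℝ) ^ (Nat.factorial N - Nat.factorial (N - 1)) ≤ (1 / 2 : ℝ) ^ 1 :=
          pow_le_pow_of_le_one (by norm_num) (by norm_num) hE
      _ < 1 := by norm_num
  have hne : ‖(psNumer 2 N : PadicAlgCl 2) - 1‖ ≠ ‖(1 : PadicAlgCl 2)‖ := by
    rw [norm_one]; exact ne_of_lt hlt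
  have := IsUltrametricDist.norm_add_eq_max_of_norm_ne_norm hne
  rw [sub_add_cancel, norm_one] at this
  rw [this]
  exact max_eq_right hlt.le

/-- Integer coefficients have norm `≤ 1`: `‖A(z)‖₂ ≤ max(1, ‖z‖₂)^{deg A}`. -/
theorem norm_aeval_le (A : ℤ[X]) (z : PadicAlgCl 2) : ‖aeval z A‖ ≤ max 1 ‖z‖ ^ A.natDegree := by
  rw [aeval_eq_sum_range]
  have h1 : (1 : ℝ) ≤ max 1 ‖z‖ := le_max_left _ _
  apply IsUltrametricDist.norm_sum_le_of_forall_le_of_nonneg (by positivity)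
  intro i hi
  rw [Finset.mem_range] at hi
  rw [zsmul_eq_mul, norm_mul, norm_pow]
  calc ‖(A.coeff i : PadicAlgCl 2)‖ * ‖z‖ ^ i ≤ 1 * (max 1 ‖z‖) ^ i := by
        gcongr
        · exact norm_intCast_le_one' _
        · exact le_max_right _ _
    _ ≤ (max 1 ‖z‖) ^ A.natDegree := by
        rw [one_mul]; exact pow_le_pow_right₀ h1 (by omega)

/-- Roots of a separable `B ∈ ℤ[Y]` in `ℂ₂`: a finset of cardinality `deg B` and the product formula. -/
theorem roots_data (B : ℤ[X]) (hB : B ≠ 0) (hsep : (B.map (Int.castRingHom ℚ)).Separable) :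
    ∃ T : Finset (PadicAlgCl 2), T.card = B.natDegree ∧ (∀ β ∈ T, aeval β B = 0) ∧
      ∀ z : PadicAlgCl 2, aeval z B = (B.leadingCoeff : PadicAlgCl 2) * ∏ β ∈ T, (z - β) := by
  classical
  set p : (PadicAlgCl 2)[X] := B.map (algebraMap ℤ (PadicAlgCl 2)) with hp
  have hinj : Function.Injective (algebraMap ℤ (PadicAlgCl 2)) := (algebraMap ℤ (PadicAlgCl 2)).injective_int
  have hp0 : p ≠ 0 := (Polynomial.map_ne_zero_iff hinj).mpr hB
  have hsep' : p.Separable := by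
    have e : p = (B.map (Int.castRingHom ℚ)).map (algebraMap ℚ (PadicAlgCl 2)) := by
      rw [hp, Polynomial.map_map]
      congr 1
    rw [e]; exact hsep.map
  have hnodup : p.roots.Nodup := nodup_roots hsep'
  have hlc : p.leadingCoeff = (B.leadingCoeff : PadicAlgCl 2) := by
    rw [hp, leadingCoeff_map_of_injective hinj]; exact eq_intCast _ _
  have hdeg : p.natDegree = B.natDegree := by rw [hp, natDegree_map_eq_of_injective hinj]
  have hcardr : p.roots.card = p.natDegree := IsAlgClosed.card_roots_eq_natDegree
  have hprod : C p.leadingCoeff * (p.roots.map fun a => X - C a).prod = p :=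
    C_leadingCoeff_mul_prod_multiset_X_sub_C hcardr
  have hval : p.roots.toFinset.val = p.roots := by
    rw [Multiset.toFinset_val, Multiset.Nodup.dedup hnodup]
  have hevp : ∀ z : PadicAlgCl 2, eval z p = aeval z B := fun z => by
    rw [hp, eval_map, ← aeval_def]
  refine ⟨p.roots.toFinset, ?_, ?_, ?_⟩
  · rw [Multiset.toFinset_card_of_nodup hnodup, hcardr, hdeg]
  · intro β hβ
    have h1 : eval β p = 0 := (mem_roots hp0).mp (Multiset.mem_toFinset.mp hβ)
    rwa [hevp] at h1
  · intro z
    rw [← hevp z, Finset.prod_eq_multiset_prod, hval]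
    conv_lhs => rw [← hprod]
    rw [eval_mul, eval_C, hlc, eval_multiset_prod, Multiset.map_map]
    congr 1
    congr 1
    refine Multiset.map_congr rfl fun x _ => ?_
    simp

end Summit.Schanuel.Schanuel.Theorems.RootDecomp1KXLinearII

end
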